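import Literature.MathematicalPhysics.QuantumFieldTheory.Balaban1983to89.Node00.N24NodesStage13PointedAtTheta13LiveSep

/-!
# ⁗ EDITION (v1.2 RE-KEY of module 43 `N24NodesStage13XReboundPointed`, REV 18: token map as in 39⁗–42⁗ + dag-n10-d's v1.2 carrier faces `Provisos₁₃Sep.rebindX` ∕
# `datumOfRecord₁₃Sep_rebindX` (`Record13CarriersSep` p502304, `rfl`); K1⁗ stmt-QuantumFields-20290; at `theta13LiveOfRecord` the (R₁₃) and `SlotsNondegenerate₁₃` slots are the
# HYPOTHESIS-FREE faces of 42⁗)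
# NODE N24 · THE X-REBOUND FOUR-PIN STAGE-13 PRESENTATION `θ.rebindX X'` — EVERY X-READING SOCKET (N05 [B8], N09 [B12], N10 [B13]) READ AT A CHOSEN CARRIER FAMILY `X'`,
# so that at node00-def-K0a's witnesses (whose residual carrier family `res.X` is the DEGENERATE `Classical.choice` one — seat dag-n10-d's LOCATED-N24-XSOCKET) the sockets
# become the nodes' LEAVES OF RECORD on choosing `X' :=` the carriers of record (e.g. `XB13OfRecord θ₃ λ₁₃ (XB12OfRecord₁₂ F N θ₁₂ λ₁₂ fun P => (θ.res.X P).withB8OfRecordSubB θ₃ λ₈)`,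
# dag-n10-d `Record13CarriersB13` ∕ `Record13CarriersSep`, dag-n05-d `Record13CarriersB8SubB`)

TRACK A (YM-PLAN §2d, node N24 of 28 = binder B2), seat `pub-ymgap-dag-n24-c` (R134 fan-out seat, strategy s2; gen 4; HANDOFF trigger (t8) REV 18).  FORTY-THIRD N24 module, a NEW importing one (imports module 42⁗
`N24NodesStage13PointedAtTheta13LiveSep`, hence 38⁗–41⁗, dag-n10-d's `Record13CarriersSep`, K0a's `Record13LiveSelector`, dag-n11-e's `B16RLeafRecord13LiveRstep` ((D), hypothesis-free (R₁₃) at the witnesses) ∕ `B16RLeafRecord13AtLive` (sign lemmas)).  THEOREMS ONLY, def-free,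
sorry-free, standard axioms.  Route rev 19: item K1⁗ `StabilityBAtRecordR13Sep` (stmt-QuantumFields-20290).

WHY (dag-n10-d g6, LOCATED-N24-XSOCKET, 04:06Z): at `theta13LiveOfRecord F N` (and every K0a family member) `θ.res.X = fun _ => Classical.choice _`, so module 42⁗'s sockets `h05 ∕ h09 ∕ h10`
read an OPAQUE carrier there — dischargeable by no seat.  THE CURE (typed here, θ-GENERIC and X'-GENERIC, ONE re-binding level so every transport is dag-n10-d's `…_rebindX` face BY NAME):
module 40⁗ at the X-REBOUND parameter `θ.rebindX F N X'` (`Record13CarriersSep` §2): `Provisos₁₃Sep.rebindX`, `rebindX_admissible_iff`, `guard_rebindX_iff`, `datumOfRecord₁₃Sep_rebindX` (SAME datum,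
`rfl`), the histories ∕ laws ∕ (UV) objects unchanged (`gOfRecord₁₃_∕betaOfRecord₁₃_∕chiβOfRecord₁₃_∕densOfRecord₁₃_rebindX`, `SLaw₁₃_TLaw₁₃_rebindX`, all `rfl`), the sockets at `X' P`
(`rebindX_res_X`, `rfl`).  A closer takes `X' :=` the composite carriers of record; then `(X' P).S13 ∕ .c13 = (WtOfRecord θ₃ (λ₁₃ P)).toStepData ∕ c13OfRecord θ₃ (λ₁₃ P)` (N10's leaf of
record `B13LeafOfRecord`, dag-n10-d), `(X' P).F12 ∕ .c12` = the [B12] frame ∕ constants of record (N09's `B12LeafOfRecord₁₂`, `Iff.rfl`), the [B8] fields = `λ₈`'s (dag-n05-d's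
`upOfRecord₅C_toStage5₁₃_pinB8SubB_b8_iff`) — all by `rfl`, no further N24 text needed.

WHAT THIS FILE PROVES (general `N`; N24 COMPOSITE — hypothesis lists are «which child blocks», nothing is discharged as a node).
§1 **`N24_nodes₁₃Sep_rebindX_fourPin_pointed`** — the thirteen nodes at a world bound to the four-pin view of `θ.rebindX X'` over `(datumOfRecord₁₃Sep θ hP).C`: N05 `B8LeafR` at `(X' P)`'s [B8]
   fields; N09 `Lemma4Printed (X' P).F12 (X' P).c12` + Theorem-3 member `h09T`; N10 socket at `(X' P).S13 ∕ .c13`; N06 ∕ N07 ∕ N12 at the chosen layers; N08 ← `PrintedUV3V N θ.L`; N11 (S1ᵀ),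
   N13 (R₁₃) `hR` + (UV₁₃) `hUV` keyed AT `θ`'s OWN histories (unchanged by the re-binding).
§2 **`N24_stabilityBR13Sep_thetaShape18_rebindX_fourPin_pointed`** (K1⁗'s θ-keyed consequent witnessed by `(θ, hP)`, guard displayed) and
   **`N24_betaWindowAtSomeRecord₁₃Sep_of_rebindX_fourPin_pointed_of_boxH`** (the ∃-body of the registered rung `BetaWindowAtSomeRecord13`, witnesses `(θ, hP, w)`).
§3 AT THE WITNESS OF RECORD `theta13LiveOfRecord F N` with `X'` FREE: **`N24_stabilityBR13Sep_thetaShape18_rebindX_fourPin_pointed_theta13LiveOfRecord`**,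
   **`N24_betaWindowAtSomeRecord₁₃Sep_of_rebindX_fourPin_pointed_theta13LiveOfRecord_of_boxH`** — `Admissible` ∕ `ZtUnity` ∕ `SlotsNondegenerate₁₃` ∕ (R₁₃) THEOREMS there (K0a FILE 8,
   dag-n11-e (A′)); every X-socket at `X' P`; N06 ∕ N07 ∕ N12 at chosen layers; N08 PRINTED.  WHICH CHILD BLOCKS K1⁗ AT THE WITNESS OF RECORD, NON-DEGENERATELY = §3's hypothesis lists.
HONEST FRAMING: kernel bookkeeping BY NAME; nothing of Bałaban's asserted; no discharge, no count moved (5∕27), no stub closed; one finite T⁴ programme at fixed ε; NOT continuum ∕ ℝ⁴ ∕ OS ∕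
mass gap ∕ Clay.
-/

noncomputable section

open scoped Matrix.Norms.L2Operator

namespace Literature.MathematicalPhysics.QuantumFieldTheory.Balaban1983to89.Node00

open DagBinding T4Continuum T4DatumAssembly FlowStepRuns AveragingRT
open FlowStep (BetaLowerH BetaUpperH)
open B16RLeafRecord13LiveRstep (laws₁₃_theta13LiveOfRecord)

variable {F : T4Family} {N : ℕ} [NeZero N]

/-! ## §1. The thirteen nodes at a world bound to the four-pin view of the X-rebound parameter, sockets at `X'` -/

/-- **N24 · THE THIRTEEN DAG NODES AT A WORLD BOUND TO THE FOUR-PIN STAGE-13 VIEW OF `θ.rebindX X'`, EVERY X-READING SOCKET AT THE CHOSEN CARRIER FAMILY `X'`** (module 40's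
`N24_nodes₁₃B10YZW_pointed_sep` at `θ.rebindX F N X'`, read back to `θ`'s datum ∕ histories ∕ laws by dag-n10-d's `…_rebindX` faces).  THE HYPOTHESIS LIST IS «WHICH CHILD BLOCKS `stub_nodes13`
OVER THE X-REBOUND FOUR-PIN VIEW».
[cite: Balaban1989LargeFieldII, Thm 1 p.355, (0.1) pp.355–356, p.387, p.391; Balaban1985UV3, Thm 1 p.257 + Thm 2 p.272; Balaban1985BackgroundPropagators, Thm 3.1 p.397; Balaban1985Variational, Thm 1 p.279 + Thm 3 p.278; Balaban1988Convergent, Thm 1 p.262, Theorem p.245, p.244, (2.18) p.257, Cor. 3 (2.50) p.264; Balaban1987RG1, Thm 1 p.259, Thm 3 p.264, Lemma 4 p.280; Balaban1988RG2Cluster, Lemmas 1–3 pp.9–20; Balaban1989LargeFieldI, Prop. 1 p.194, (0.2)–(0.4) p.176; Balaban1985RegularSpaces, Thm 2 p.83 (bookkeeping)] -/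
theorem N24_nodes₁₃Sep_rebindX_fourPin_pointed (θ : Stage13Params F N) (hP : θ.Provisos₁₃Sep F N) (hθ : θ.Admissible F N)
    (X' : B12.RunParams → PrintedCarriersR) (Mstar : ℕ) (ops : OpsY N θ.toStage3Params Mstar) (ζ : ResidZ F N) (lamW : ResidW F N) (w : WorldP)
    (hC : w.C = (datumOfRecord₁₃Sep F N θ hP).C) (hγ : 0 < w.γ ∧ w.γ ≤ θ.γ) (hL : w.L = (θ.L : ℝ))
    (hup : ∀ P, w.up P = upOfRecord₅C F N ((θ.rebindX F N X').view₁₃B10YZW F N Mstar ops ζ lamW) P)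
    (h05 : ∀ P : B12.RunParams,
      B8LeafR (X' P).d8 (X' P).L8 (X' P).C₂ (X' P).B₁' (X' P).B₀' (X' P).B₁ (X' P).B₂ (X' P).c₁
        (X' P).inp8 (X' P).B₀β (X' P).loc8 (X' P).fam8R (X' P).lan8 (X' P).cub8 (X' P).toAxial8)
    (h06 : B9LeafX (Y9OfRecord N θ.toStage3Params Mstar ops))
    (h07 : B11Leaf (Z11OfRecord F N ζ))
    (h08 : PrintedUV3V N θ.L)
    (h09 : ∀ P : B12.RunParams, B12Sec2to5.Lemma4Printed (X' P).F12 (X' P).c12)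
    (h09T : ∀ P : B12.RunParams, (leavesP w P).smallCouplings → (leavesP w P).smallFieldInductive)
    (h10 : ∀ P : B12.RunParams, B9LeafX (Y9OfRecord N θ.toStage3Params Mstar ops) →
      (B10.Thm1PrintedCompact (((θ.rebindX F N X').view₁₃B10YZW F N Mstar ops ζ lamW).res.X P).runs10 ∧
          B10.Thm2Printed (((θ.rebindX F N X').view₁₃B10YZW F N Mstar ops ζ lamW).res.X P).runs10) →
        B11Leaf (Z11OfRecord F N ζ) → B12Sec2to5.Lemma4Printed (X' P).F12 (X' P).c12 →
          B13.Lemma1Printed (X' P).S13 (X' P).c13 ∧ B13.Lemma2Printed (X' P).S13 (X' P).c13 ∧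
            B13.Lemma3Printed (X' P).S13 (X' P).c13)
    (h11 : ∀ P : B12.RunParams, (leavesP w P).b7 → (leavesP w P).b8 → (leavesP w P).b9 → (leavesP w P).b10 → (leavesP w P).b11 →
      (leavesP w P).smallCouplings → (leavesP w P).smallFieldInductive → (leavesP w P).flowControl →
        ∀ k, k < P.K → SLaw₁₃ F N θ P k → TLaw₁₃ F N θ P k)
    (h12 : ∀ P : B12.RunParams, B15Leaf (WOfRecord₁₃ F N θ lamW P))
    (hR : ∀ (P : B12.RunParams) (k : ℕ), k < P.K → TLaw₁₃ F N θ P k → SLaw₁₃ F N θ P (k + 1))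
    (hUV : ∀ P : B12.RunParams, (genFlow (betaOfRecord₁₃ F N θ) P.g0).InInterval w.γ P.K → ∀ k, k ≤ P.K → SLaw₁₃ F N θ P k →
      ∀ U : GaugeField (F.P P.K) k (SU N),
        chiβOfRecord₁₃ F N θ P.K (gOfRecord₁₃ F N θ P) k U *
              Real.exp (-(1 / (gOfRecord₁₃ F N θ P k) ^ 2 * wilsonBGOfRecord F N θ.εbg P k U)
                - w.em (gOfRecord₁₃ F N θ P k) * (Fintype.card (Site (F.P P.K) k) : ℝ)) ≤ densOfRecord₁₃ F N θ P k U ∧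
        densOfRecord₁₃ F N θ P k U ≤ Real.exp (w.ep (gOfRecord₁₃ F N θ P k) * (Fintype.card (Site (F.P P.K) k) : ℝ))) :
    IsRecordOfRecord₁₃CSep F N (datumOfRecord₁₃Sep F N θ hP) w ∧ ∀ P : B12.RunParams, Nodes (leavesP w P) := by
  have hX : (θ.rebindX F N X').Provisos₁₃Sep F N := hP.rebindX X'
  have hn := N24_nodes₁₃B10YZW_pointed_sep (θ.rebindX F N X') hX ((Stage13Params.rebindX_admissible_iff F N θ X').2 hθ) Mstar ops ζ lamW w
    (hC.trans (congrArg FiniteEpsData.C (datumOfRecord₁₃Sep_rebindX F N θ hP X' hX).symm)) hγ hL hup h05 h06 h07 h08 h09 h09T h10 h11 h12 hR hUV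
  exact ⟨(datumOfRecord₁₃Sep_rebindX F N θ hP X' hX) ▸ hn.1, hn.2⟩

/-! ## §2. Item K1⁗'s θ-keyed consequent and the rung body `BetaWindowAtSomeRecord13` over the X-rebound four-pin view -/

/-- **ITEM K1⁗'s θ-KEYED CONSEQUENT WITNESSED BY `(θ, hP)` FROM THE POINTED CHILDREN OVER THE X-REBOUND FOUR-PIN VIEW** (§1 into def-T's
`endStatementBPrinted_of_isRecordOfRecord₁₃CSep_of_nodes` + module 38's interval β-binder + module 26's window; guard `hU` displayed).  COMPOSITE.
[cite: Balaban1989LargeFieldII, Thm 1 p.355, (0.1) pp.355–356, p.391; Balaban1988Convergent, (3.16)–(3.22) pp.268–269; Balaban1987RG1, Thm 3 p.264, (0.17)–(0.20) pp.255–256 and (1.22) p.264, (2.9) p.266; Balaban1985UV3, Thm 1 p.257 (bookkeeping + elementary window)] -/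
theorem N24_stabilityBR13Sep_thetaShape18_rebindX_fourPin_pointed (θ : Stage13Params F N) (hP : θ.Provisos₁₃Sep F N) (hθ : θ.Admissible F N)
    (hU : θ.ZtUnity F N ∧ θ.SlotsNondegenerate₁₃ F N)
    (X' : B12.RunParams → PrintedCarriersR) (Mstar : ℕ) (ops : OpsY N θ.toStage3Params Mstar) (ζ : ResidZ F N) (lamW : ResidW F N)
    (w : WorldP)
    (hC : w.C = (datumOfRecord₁₃Sep F N θ hP).C) (hγ : 0 < w.γ ∧ w.γ ≤ θ.γ) (hL : w.L = (θ.L : ℝ))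
    (hup : ∀ P, w.up P = upOfRecord₅C F N ((θ.rebindX F N X').view₁₃B10YZW F N Mstar ops ζ lamW) P)
    (h05 : ∀ P : B12.RunParams,
      B8LeafR (X' P).d8 (X' P).L8 (X' P).C₂ (X' P).B₁' (X' P).B₀' (X' P).B₁ (X' P).B₂ (X' P).c₁
        (X' P).inp8 (X' P).B₀β (X' P).loc8 (X' P).fam8R (X' P).lan8 (X' P).cub8 (X' P).toAxial8)
    (h06 : B9LeafX (Y9OfRecord N θ.toStage3Params Mstar ops))
    (h07 : B11Leaf (Z11OfRecord F N ζ))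
    (h08 : PrintedUV3V N θ.L)
    (h09 : ∀ P : B12.RunParams, B12Sec2to5.Lemma4Printed (X' P).F12 (X' P).c12)
    (h09T : ∀ P : B12.RunParams, (leavesP w P).smallCouplings → (leavesP w P).smallFieldInductive)
    (h10 : ∀ P : B12.RunParams, B9LeafX (Y9OfRecord N θ.toStage3Params Mstar ops) →
      (B10.Thm1PrintedCompact (((θ.rebindX F N X').view₁₃B10YZW F N Mstar ops ζ lamW).res.X P).runs10 ∧
          B10.Thm2Printed (((θ.rebindX F N X').view₁₃B10YZW F N Mstar ops ζ lamW).res.X P).runs10) →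
        B11Leaf (Z11OfRecord F N ζ) → B12Sec2to5.Lemma4Printed (X' P).F12 (X' P).c12 →
          B13.Lemma1Printed (X' P).S13 (X' P).c13 ∧ B13.Lemma2Printed (X' P).S13 (X' P).c13 ∧
            B13.Lemma3Printed (X' P).S13 (X' P).c13)
    (h11 : ∀ P : B12.RunParams, (leavesP w P).b7 → (leavesP w P).b8 → (leavesP w P).b9 → (leavesP w P).b10 → (leavesP w P).b11 →
      (leavesP w P).smallCouplings → (leavesP w P).smallFieldInductive → (leavesP w P).flowControl →
        ∀ k, k < P.K → SLaw₁₃ F N θ P k → TLaw₁₃ F N θ P k)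
    (h12 : ∀ P : B12.RunParams, B15Leaf (WOfRecord₁₃ F N θ lamW P))
    (hR : ∀ (P : B12.RunParams) (k : ℕ), k < P.K → TLaw₁₃ F N θ P k → SLaw₁₃ F N θ P (k + 1))
    (hUV : ∀ P : B12.RunParams, (genFlow (betaOfRecord₁₃ F N θ) P.g0).InInterval w.γ P.K → ∀ k, k ≤ P.K → SLaw₁₃ F N θ P k →
      ∀ U : GaugeField (F.P P.K) k (SU N),
        chiβOfRecord₁₃ F N θ P.K (gOfRecord₁₃ F N θ P) k U *
              Real.exp (-(1 / (gOfRecord₁₃ F N θ P k) ^ 2 * wilsonBGOfRecord F N θ.εbg P k U)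
                - w.em (gOfRecord₁₃ F N θ P k) * (Fintype.card (Site (F.P P.K) k) : ℝ)) ≤ densOfRecord₁₃ F N θ P k U ∧
        densOfRecord₁₃ F N θ P k U ≤ Real.exp (w.ep (gOfRecord₁₃ F N θ P k) * (Fintype.card (Site (F.P P.K) k) : ℝ)))
    (hlo : BetaLowerH w.b w.γ (datumOfRecord₁₃Sep F N θ hP).βfun) (hhi : BetaUpperH w.βup w.γ (datumOfRecord₁₃Sep F N θ hP).βfun) :
    ∃ (θ' : Stage13Params F N) (h' : θ'.Provisos₁₃Sep F N), (θ'.ZtUnity F N ∧ θ'.SlotsNondegenerate₁₃ F N) ∧ θ'.Admissible F N ∧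
      B16.EndStatementBPrinted (datumOfRecord₁₃Sep F N θ' h').C ∧
      ∃ γ₁ : ℝ, 0 < γ₁ ∧ ∀ γ : ℝ, 0 < γ → γ ≤ γ₁ → ∃ P : B12.RunParams, 1 ≤ P.K ∧ ((datumOfRecord₁₃Sep F N θ' h').C P).flow.InInterval γ P.K := by
  obtain ⟨hrec, hn⟩ := N24_nodes₁₃Sep_rebindX_fourPin_pointed θ hP hθ X' Mstar ops ζ lamW w hC hγ hL hup h05 h06 h07 h08 h09 h09T h10 h11 h12 hR hUV
  exact ⟨θ, hP, hU, hθ, endStatementBPrinted_of_isRecordOfRecord₁₃CSep_of_nodes hrec le_rfl hn (N24_betaBoundsInInterval_of_isRecordOfRecord₁₃CSep_of_boxH hrec hlo hhi),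
    N24_window_of_betaUpperH _ hγ.1 hhi⟩

/-- **THE ∃-BODY OF `BetaWindowAtSomeRecord13` OVER THE X-REBOUND FOUR-PIN VIEW**, witnesses `(θ, hP, w)` (guard `hU` displayed).
[cite: Balaban1989LargeFieldII, Thm 1 p.355, (0.1) pp.355–356, p.391; Balaban1987RG1, Thm 3 p.264, (0.17)–(0.20) pp.255–256 and (1.22) p.264, (2.9) p.266; Balaban1985UV3, Thm 1 p.257 (bookkeeping + elementary window)] -/
theorem N24_betaWindowAtSomeRecord₁₃Sep_of_rebindX_fourPin_pointed_of_boxH (θ : Stage13Params F N) (hP : θ.Provisos₁₃Sep F N) (hθ : θ.Admissible F N)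
    (hU : θ.ZtUnity F N ∧ θ.SlotsNondegenerate₁₃ F N)
    (X' : B12.RunParams → PrintedCarriersR) (Mstar : ℕ) (ops : OpsY N θ.toStage3Params Mstar) (ζ : ResidZ F N) (lamW : ResidW F N)
    (w : WorldP)
    (hC : w.C = (datumOfRecord₁₃Sep F N θ hP).C) (hγ : 0 < w.γ ∧ w.γ ≤ θ.γ) (hL : w.L = (θ.L : ℝ))
    (hup : ∀ P, w.up P = upOfRecord₅C F N ((θ.rebindX F N X').view₁₃B10YZW F N Mstar ops ζ lamW) P)
    (h05 : ∀ P : B12.RunParams,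
      B8LeafR (X' P).d8 (X' P).L8 (X' P).C₂ (X' P).B₁' (X' P).B₀' (X' P).B₁ (X' P).B₂ (X' P).c₁
        (X' P).inp8 (X' P).B₀β (X' P).loc8 (X' P).fam8R (X' P).lan8 (X' P).cub8 (X' P).toAxial8)
    (h06 : B9LeafX (Y9OfRecord N θ.toStage3Params Mstar ops))
    (h07 : B11Leaf (Z11OfRecord F N ζ))
    (h08 : PrintedUV3V N θ.L)
    (h09 : ∀ P : B12.RunParams, B12Sec2to5.Lemma4Printed (X' P).F12 (X' P).c12)
    (h09T : ∀ P : B12.RunParams, (leavesP w P).smallCouplings → (leavesP w P).smallFieldInductive)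
    (h10 : ∀ P : B12.RunParams, B9LeafX (Y9OfRecord N θ.toStage3Params Mstar ops) →
      (B10.Thm1PrintedCompact (((θ.rebindX F N X').view₁₃B10YZW F N Mstar ops ζ lamW).res.X P).runs10 ∧
          B10.Thm2Printed (((θ.rebindX F N X').view₁₃B10YZW F N Mstar ops ζ lamW).res.X P).runs10) →
        B11Leaf (Z11OfRecord F N ζ) → B12Sec2to5.Lemma4Printed (X' P).F12 (X' P).c12 →
          B13.Lemma1Printed (X' P).S13 (X' P).c13 ∧ B13.Lemma2Printed (X' P).S13 (X' P).c13 ∧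
            B13.Lemma3Printed (X' P).S13 (X' P).c13)
    (h11 : ∀ P : B12.RunParams, (leavesP w P).b7 → (leavesP w P).b8 → (leavesP w P).b9 → (leavesP w P).b10 → (leavesP w P).b11 →
      (leavesP w P).smallCouplings → (leavesP w P).smallFieldInductive → (leavesP w P).flowControl →
        ∀ k, k < P.K → SLaw₁₃ F N θ P k → TLaw₁₃ F N θ P k)
    (h12 : ∀ P : B12.RunParams, B15Leaf (WOfRecord₁₃ F N θ lamW P))
    (hR : ∀ (P : B12.RunParams) (k : ℕ), k < P.K → TLaw₁₃ F N θ P k → SLaw₁₃ F N θ P (k + 1))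
    (hUV : ∀ P : B12.RunParams, (genFlow (betaOfRecord₁₃ F N θ) P.g0).InInterval w.γ P.K → ∀ k, k ≤ P.K → SLaw₁₃ F N θ P k →
      ∀ U : GaugeField (F.P P.K) k (SU N),
        chiβOfRecord₁₃ F N θ P.K (gOfRecord₁₃ F N θ P) k U *
              Real.exp (-(1 / (gOfRecord₁₃ F N θ P k) ^ 2 * wilsonBGOfRecord F N θ.εbg P k U)
                - w.em (gOfRecord₁₃ F N θ P k) * (Fintype.card (Site (F.P P.K) k) : ℝ)) ≤ densOfRecord₁₃ F N θ P k U ∧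
        densOfRecord₁₃ F N θ P k U ≤ Real.exp (w.ep (gOfRecord₁₃ F N θ P k) * (Fintype.card (Site (F.P P.K) k) : ℝ)))
    (hlo : BetaLowerH w.b w.γ (datumOfRecord₁₃Sep F N θ hP).βfun) (hhi : BetaUpperH w.βup w.γ (datumOfRecord₁₃Sep F N θ hP).βfun) :
    ∃ (θ' : Stage13Params F N) (h' : θ'.Provisos₁₃Sep F N) (w' : WorldP), (θ'.ZtUnity F N ∧ θ'.SlotsNondegenerate₁₃ F N) ∧ θ'.Admissible F N ∧
      IsRecordOfRecord₁₃CSep F N (datumOfRecord₁₃Sep F N θ' h') w' ∧ (∀ P : B12.RunParams, Nodes (leavesP w' P)) ∧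
      BetaBoundsInInterval w'.C.toB12 w'.γ w'.b w'.βup ∧
      ∃ γ₁ : ℝ, 0 < γ₁ ∧ ∀ γ : ℝ, 0 < γ → γ ≤ γ₁ → ∃ P : B12.RunParams, 1 ≤ P.K ∧ ((datumOfRecord₁₃Sep F N θ' h').C P).flow.InInterval γ P.K := by
  obtain ⟨hrec, hn⟩ := N24_nodes₁₃Sep_rebindX_fourPin_pointed θ hP hθ X' Mstar ops ζ lamW w hC hγ hL hup h05 h06 h07 h08 h09 h09T h10 h11 h12 hR hUV
  exact ⟨θ, hP, w, hU, hθ, hrec, hn, N24_betaBoundsInInterval_of_isRecordOfRecord₁₃CSep_of_boxH hrec hlo hhi, N24_window_of_betaUpperH _ hγ.1 hhi⟩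

/-! ## §3. At node00-def-K0a's witness of record with the carrier family re-bound: every θ-level slot a theorem, every X-socket at `X'` -/

/-- **★ ITEM K1⁗'s θ-KEYED CONSEQUENT WITNESSED BY `(theta13LiveOfRecord F N, hP)`, THE CHILDREN READ OVER THE FOUR-PIN VIEW OF `(theta13LiveOfRecord F N).rebindX X'`** — `Admissible`
(`admissible_theta13LiveOfRecord`), guard (`ztUnity_theta13LiveOfRecord` ∕ K0a's HYPOTHESIS-FREE `slotsNondegenerate₁₃_theta13LiveOfRecord_of_hasResiduals`), N13's (R₁₃) (dag-n11-e's HYPOTHESIS-FREE `B16RLeafRecord13LiveRstep.laws₁₃_theta13LiveOfRecord`) THEOREMS; N05 ∕ N09 ∕ N10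
sockets at `X' P` (NOT at the witness's degenerate `res.X` — dag-n10-d LOCATED-N24-XSOCKET), N06 ∕ N07 ∕ N12 at chosen layers, N08 ← `PrintedUV3V`.  THE HYPOTHESIS LIST IS «WHICH CHILD
BLOCKS K1⁗ AT THE WITNESS OF RECORD», non-degenerately.  COMPOSITE.
[cite: Balaban1989LargeFieldII, Thm 1 p.355, (0.1) pp.355–356, p.391; Balaban1988Convergent, p.244, Thm 2 p.263, (3.16)–(3.22) pp.268–269, (3.24)–(3.25) p.270; Balaban1989LargeFieldI, (0.2)–(0.4) p.176; Balaban1987RG1, Thm 3 p.264, (0.17)–(0.21) pp.255–256 and (1.22) p.264; Balaban1985UV3, Thm 1 p.257 + Thm 2 p.272 (bookkeeping + elementary window)] -/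
theorem N24_stabilityBR13Sep_thetaShape18_rebindX_fourPin_pointed_theta13LiveOfRecord (hP : (theta13LiveOfRecord F N).Provisos₁₃Sep F N) (X' : B12.RunParams → PrintedCarriersR)
    (Mstar : ℕ) (ops : OpsY N (theta13LiveOfRecord F N).toStage3Params Mstar) (ζ : ResidZ F N) (lamW : ResidW F N) (w : WorldP)
    (hC : w.C = (datumOfRecord₁₃Sep F N (theta13LiveOfRecord F N) hP).C) (hγ : 0 < w.γ ∧ w.γ ≤ (theta13LiveOfRecord F N).γ) (hL : w.L = ((theta13LiveOfRecord F N).L : ℝ))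
    (hup : ∀ P, w.up P = upOfRecord₅C F N (((theta13LiveOfRecord F N).rebindX F N X').view₁₃B10YZW F N Mstar ops ζ lamW) P)
    (h05 : ∀ P : B12.RunParams,
      B8LeafR (X' P).d8 (X' P).L8 (X' P).C₂ (X' P).B₁' (X' P).B₀' (X' P).B₁ (X' P).B₂ (X' P).c₁
        (X' P).inp8 (X' P).B₀β (X' P).loc8 (X' P).fam8R (X' P).lan8 (X' P).cub8 (X' P).toAxial8)
    (h06 : B9LeafX (Y9OfRecord N (theta13LiveOfRecord F N).toStage3Params Mstar ops))
    (h07 : B11Leaf (Z11OfRecord F N ζ))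
    (h08 : PrintedUV3V N (theta13LiveOfRecord F N).L)
    (h09 : ∀ P : B12.RunParams, B12Sec2to5.Lemma4Printed (X' P).F12 (X' P).c12)
    (h09T : ∀ P : B12.RunParams, (leavesP w P).smallCouplings → (leavesP w P).smallFieldInductive)
    (h10 : ∀ P : B12.RunParams, B9LeafX (Y9OfRecord N (theta13LiveOfRecord F N).toStage3Params Mstar ops) →
      (B10.Thm1PrintedCompact ((((theta13LiveOfRecord F N).rebindX F N X').view₁₃B10YZW F N Mstar ops ζ lamW).res.X P).runs10 ∧
          B10.Thm2Printed ((((theta13LiveOfRecord F N).rebindX F N X').view₁₃B10YZW F N Mstar ops ζ lamW).res.X P).runs10) →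
        B11Leaf (Z11OfRecord F N ζ) → B12Sec2to5.Lemma4Printed (X' P).F12 (X' P).c12 →
          B13.Lemma1Printed (X' P).S13 (X' P).c13 ∧ B13.Lemma2Printed (X' P).S13 (X' P).c13 ∧
            B13.Lemma3Printed (X' P).S13 (X' P).c13)
    (h11 : ∀ P : B12.RunParams, (leavesP w P).b7 → (leavesP w P).b8 → (leavesP w P).b9 → (leavesP w P).b10 → (leavesP w P).b11 →
      (leavesP w P).smallCouplings → (leavesP w P).smallFieldInductive → (leavesP w P).flowControl →
        ∀ k, k < P.K → SLaw₁₃ F N (theta13LiveOfRecord F N) P k → TLaw₁₃ F N (theta13LiveOfRecord F N) P k)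
    (h12 : ∀ P : B12.RunParams, B15Leaf (WOfRecord₁₃ F N (theta13LiveOfRecord F N) lamW P))
    (hUV : ∀ P : B12.RunParams, (genFlow (betaOfRecord₁₃ F N (theta13LiveOfRecord F N)) P.g0).InInterval w.γ P.K → ∀ k, k ≤ P.K → SLaw₁₃ F N (theta13LiveOfRecord F N) P k →
      ∀ U : GaugeField (F.P P.K) k (SU N),
        chiβOfRecord₁₃ F N (theta13LiveOfRecord F N) P.K (gOfRecord₁₃ F N (theta13LiveOfRecord F N) P) k U *
              Real.exp (-(1 / (gOfRecord₁₃ F N (theta13LiveOfRecord F N) P k) ^ 2 * wilsonBGOfRecord F N (theta13LiveOfRecord F N).εbg P k U)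
                - w.em (gOfRecord₁₃ F N (theta13LiveOfRecord F N) P k) * (Fintype.card (Site (F.P P.K) k) : ℝ)) ≤ densOfRecord₁₃ F N (theta13LiveOfRecord F N) P k U ∧
        densOfRecord₁₃ F N (theta13LiveOfRecord F N) P k U ≤ Real.exp (w.ep (gOfRecord₁₃ F N (theta13LiveOfRecord F N) P k) * (Fintype.card (Site (F.P P.K) k) : ℝ)))
    (hlo : BetaLowerH w.b w.γ (datumOfRecord₁₃Sep F N (theta13LiveOfRecord F N) hP).βfun) (hhi : BetaUpperH w.βup w.γ (datumOfRecord₁₃Sep F N (theta13LiveOfRecord F N) hP).βfun) :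
    ∃ (θ' : Stage13Params F N) (h' : θ'.Provisos₁₃Sep F N), (θ'.ZtUnity F N ∧ θ'.SlotsNondegenerate₁₃ F N) ∧ θ'.Admissible F N ∧
      B16.EndStatementBPrinted (datumOfRecord₁₃Sep F N θ' h').C ∧
      ∃ γ₁ : ℝ, 0 < γ₁ ∧ ∀ γ : ℝ, 0 < γ → γ ≤ γ₁ → ∃ P : B12.RunParams, 1 ≤ P.K ∧ ((datumOfRecord₁₃Sep F N θ' h').C P).flow.InInterval γ P.K :=
  N24_stabilityBR13Sep_thetaShape18_rebindX_fourPin_pointed (theta13LiveOfRecord F N) hP (admissible_theta13LiveOfRecord F N)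
    ⟨ztUnity_theta13LiveOfRecord F N, slotsNondegenerate₁₃_theta13LiveOfRecord_of_hasResiduals F N⟩ X' Mstar ops ζ lamW w hC hγ hL hup h05 h06 h07 h08 h09 h09T h10 h11 h12
    (fun P k hk => laws₁₃_theta13LiveOfRecord F N P k hk) hUV hlo hhi

/-- **★ THE ∃-BODY OF `BetaWindowAtSomeRecord13` WITNESSED BY `(theta13LiveOfRecord F N, hP, w)`, CHILDREN OVER THE X-REBOUND FOUR-PIN VIEW** (same slots; WHICH CHILD BLOCKS
`stub_betaWindow13` ∕ `stub_nodes13` at the witness of record, non-degenerately).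
[cite: Balaban1989LargeFieldII, Thm 1 p.355, (0.1) pp.355–356, p.391; Balaban1988Convergent, p.244, Thm 2 p.263; Balaban1987RG1, Thm 3 p.264, (0.17)–(0.21) pp.255–256 and (1.22) p.264; Balaban1985UV3, Thm 1 p.257 (bookkeeping + elementary window)] -/
theorem N24_betaWindowAtSomeRecord₁₃Sep_of_rebindX_fourPin_pointed_theta13LiveOfRecord_of_boxH (hP : (theta13LiveOfRecord F N).Provisos₁₃Sep F N) (X' : B12.RunParams → PrintedCarriersR)
    (Mstar : ℕ) (ops : OpsY N (theta13LiveOfRecord F N).toStage3Params Mstar) (ζ : ResidZ F N) (lamW : ResidW F N) (w : WorldP)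
    (hC : w.C = (datumOfRecord₁₃Sep F N (theta13LiveOfRecord F N) hP).C) (hγ : 0 < w.γ ∧ w.γ ≤ (theta13LiveOfRecord F N).γ) (hL : w.L = ((theta13LiveOfRecord F N).L : ℝ))
    (hup : ∀ P, w.up P = upOfRecord₅C F N (((theta13LiveOfRecord F N).rebindX F N X').view₁₃B10YZW F N Mstar ops ζ lamW) P)
    (h05 : ∀ P : B12.RunParams,
      B8LeafR (X' P).d8 (X' P).L8 (X' P).C₂ (X' P).B₁' (X' P).B₀' (X' P).B₁ (X' P).B₂ (X' P).c₁
        (X' P).inp8 (X' P).B₀β (X' P).loc8 (X' P).fam8R (X' P).lan8 (X' P).cub8 (X' P).toAxial8)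
    (h06 : B9LeafX (Y9OfRecord N (theta13LiveOfRecord F N).toStage3Params Mstar ops))
    (h07 : B11Leaf (Z11OfRecord F N ζ))
    (h08 : PrintedUV3V N (theta13LiveOfRecord F N).L)
    (h09 : ∀ P : B12.RunParams, B12Sec2to5.Lemma4Printed (X' P).F12 (X' P).c12)
    (h09T : ∀ P : B12.RunParams, (leavesP w P).smallCouplings → (leavesP w P).smallFieldInductive)
    (h10 : ∀ P : B12.RunParams, B9LeafX (Y9OfRecord N (theta13LiveOfRecord F N).toStage3Params Mstar ops) →
      (B10.Thm1PrintedCompact ((((theta13LiveOfRecord F N).rebindX F N X').view₁₃B10YZW F N Mstar ops ζ lamW).res.X P).runs10 ∧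
          B10.Thm2Printed ((((theta13LiveOfRecord F N).rebindX F N X').view₁₃B10YZW F N Mstar ops ζ lamW).res.X P).runs10) →
        B11Leaf (Z11OfRecord F N ζ) → B12Sec2to5.Lemma4Printed (X' P).F12 (X' P).c12 →
          B13.Lemma1Printed (X' P).S13 (X' P).c13 ∧ B13.Lemma2Printed (X' P).S13 (X' P).c13 ∧
            B13.Lemma3Printed (X' P).S13 (X' P).c13)
    (h11 : ∀ P : B12.RunParams, (leavesP w P).b7 → (leavesP w P).b8 → (leavesP w P).b9 → (leavesP w P).b10 → (leavesP w P).b11 →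
      (leavesP w P).smallCouplings → (leavesP w P).smallFieldInductive → (leavesP w P).flowControl →
        ∀ k, k < P.K → SLaw₁₃ F N (theta13LiveOfRecord F N) P k → TLaw₁₃ F N (theta13LiveOfRecord F N) P k)
    (h12 : ∀ P : B12.RunParams, B15Leaf (WOfRecord₁₃ F N (theta13LiveOfRecord F N) lamW P))
    (hUV : ∀ P : B12.RunParams, (genFlow (betaOfRecord₁₃ F N (theta13LiveOfRecord F N)) P.g0).InInterval w.γ P.K → ∀ k, k ≤ P.K → SLaw₁₃ F N (theta13LiveOfRecord F N) P k →
      ∀ U : GaugeField (F.P P.K) k (SU N),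
        chiβOfRecord₁₃ F N (theta13LiveOfRecord F N) P.K (gOfRecord₁₃ F N (theta13LiveOfRecord F N) P) k U *
              Real.exp (-(1 / (gOfRecord₁₃ F N (theta13LiveOfRecord F N) P k) ^ 2 * wilsonBGOfRecord F N (theta13LiveOfRecord F N).εbg P k U)
                - w.em (gOfRecord₁₃ F N (theta13LiveOfRecord F N) P k) * (Fintype.card (Site (F.P P.K) k) : ℝ)) ≤ densOfRecord₁₃ F N (theta13LiveOfRecord F N) P k U ∧
        densOfRecord₁₃ F N (theta13LiveOfRecord F N) P k U ≤ Real.exp (w.ep (gOfRecord₁₃ F N (theta13LiveOfRecord F N) P k) * (Fintype.card (Site (F.P P.K) k) : ℝ)))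
    (hlo : BetaLowerH w.b w.γ (datumOfRecord₁₃Sep F N (theta13LiveOfRecord F N) hP).βfun) (hhi : BetaUpperH w.βup w.γ (datumOfRecord₁₃Sep F N (theta13LiveOfRecord F N) hP).βfun) :
    ∃ (θ' : Stage13Params F N) (h' : θ'.Provisos₁₃Sep F N) (w' : WorldP), (θ'.ZtUnity F N ∧ θ'.SlotsNondegenerate₁₃ F N) ∧ θ'.Admissible F N ∧
      IsRecordOfRecord₁₃CSep F N (datumOfRecord₁₃Sep F N θ' h') w' ∧ (∀ P : B12.RunParams, Nodes (leavesP w' P)) ∧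
      BetaBoundsInInterval w'.C.toB12 w'.γ w'.b w'.βup ∧
      ∃ γ₁ : ℝ, 0 < γ₁ ∧ ∀ γ : ℝ, 0 < γ → γ ≤ γ₁ → ∃ P : B12.RunParams, 1 ≤ P.K ∧ ((datumOfRecord₁₃Sep F N θ' h').C P).flow.InInterval γ P.K :=
  N24_betaWindowAtSomeRecord₁₃Sep_of_rebindX_fourPin_pointed_of_boxH (theta13LiveOfRecord F N) hP (admissible_theta13LiveOfRecord F N)
    ⟨ztUnity_theta13LiveOfRecord F N, slotsNondegenerate₁₃_theta13LiveOfRecord_of_hasResiduals F N⟩ X' Mstar ops ζ lamW w hC hγ hL hup h05 h06 h07 h08 h09 h09T h10 h11 h12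
    (fun P k hk => laws₁₃_theta13LiveOfRecord F N P k hk) hUV hlo hhi

end Literature.MathematicalPhysics.QuantumFieldTheory.Balaban1983to89.Node00

end
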